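import Summits.Ventures.PercRepro.RankLevelSetExplicitLin2KeyCube

/-!
# PercRepro — THE LEVEL-14 CUBE ROW OF C-025: THE KEY AT `p = 60 904` AND THE CONDITIONAL LEVEL STEP (p9, S4)

`proofs/SUBCLAIM-S4-p9.md` §S4.2⁗‴. The saturated row of record at level `14` is `p ≥ 181 515` (RankLevelSetExplicitLin2RowFourteen).
With p4's cube multiplicity the assembled inequality `(P_d)` holds, exactly evaluated, at EVERY core corank `15 ≤ d ≤ 16398`
from `p = 60 904` — and fails at `p = 60 903` (corank `10 225`, the big class's saturation corank):
the cube key `KeyC 14 60904 d` (RankLevelSetExplicitLin2KeyCube) is checked by the kernel at the 16 384 coranks (`decide`, 4 chunks of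
4 096), and `c025_level_succ_of_keyC_row` turns the row into the level step
**`c025_fourteen_cube_step (hprev : ∀ M p, 60 903 ≤ p → RLS M p 13) : ∀ M p, 60 904 ≤ p → RLS M p 14`** (`N₁(14) = 33 220`,
tail `32 843`). The unconditional rows are composed in RankLevelSetExplicitLin2CubeFloor. Axioms: standard.
-/

open scoped Matroid

namespace PercRepro

namespace ThmN

namespace Explicit

/-- The cube key row at `(q, p) = (14, 60 904)`, chunk 1 of 4: coranks `15 … 4110`, by the kernel. -/
theorem key_fourteen_cube_row_1 : ∀ t < 4096, KeyC 14 60904 (15 + t) := by decide +kernel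

/-- The cube key row at `(q, p) = (14, 60 904)`, chunk 2 of 4: coranks `4111 … 8206`, by the kernel. -/
theorem key_fourteen_cube_row_2 : ∀ t < 4096, KeyC 14 60904 (15 + (4096 + t)) := by decide +kernel

/-- The cube key row at `(q, p) = (14, 60 904)`, chunk 3 of 4: coranks `8207 … 12302`, by the kernel. -/
theorem key_fourteen_cube_row_3 : ∀ t < 4096, KeyC 14 60904 (15 + (8192 + t)) := by decide +kernel

/-- The cube key row at `(q, p) = (14, 60 904)`, chunk 4 of 4: coranks `12303 … 16398`, by the kernel. -/
theorem key_fourteen_cube_row_4 : ∀ t < 4096, KeyC 14 60904 (15 + (12288 + t)) := by decide +kernel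

/-- **THE CUBE KEY ROW AT `(q, p) = (14, 60 904)`**: `KeyC 14 60904 d` at every corank `15 ≤ d ≤ 16398` (the 4 chunks). -/
theorem key_fourteen_cube_row : ∀ t < 16384, KeyC 14 60904 (15 + t) :=
  ball_lt_add (fun t => KeyC 14 60904 (15 + t)) 12288 4096
    (ball_lt_add (fun t => KeyC 14 60904 (15 + t)) 8192 4096
    (ball_lt_add (fun t => KeyC 14 60904 (15 + t)) 4096 4096
    (key_fourteen_cube_row_1) key_fourteen_cube_row_2) key_fourteen_cube_row_3) key_fourteen_cube_row_4

/-- **THE CUBE FLOOR IS EXACT**: the cube key FAILS at `p = 60 903`, corank `10 225` (the big class's saturation corank), by the kernel. -/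
theorem key_fourteen_cube_sharp : ¬ KeyC 14 60903 10225 := by decide +kernel

end Explicit

variable {α : Type}

/-- **THE LEVEL-14 CUBE STEP FROM `60 904`**: level `14` for every finite matroid and every `p ≥ 60 904` from level `13` for
every `p ≥ 60 903` — the cube key row at `60 904`, its monotonicity in `p`, and the wrapper `c025_level_succ_of_keyC_row`
(`N₁(14) = 33 220 ≤ 60 904`, tail `32 843 ≤ 60 904`). -/
theorem c025_fourteen_cube_step (hprev : ∀ (M : Matroid α) [M.Finite] (p : ℕ), 60903 ≤ p → RLS M p 13) :
    ∀ (M : Matroid α) [M.Finite] (p : ℕ), 60904 ≤ p → RLS M p 14 :=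
  c025_level_succ_of_keyC_row 13 (by norm_num) 60904 (by norm_num) (by norm_num) Explicit.key_fourteen_cube_row hprev

end ThmN

end PercRepro
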